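import Mathlib
import Summits.Ventures.PercRepro2.Defs
import Summits.Ventures.PercRepro2.Independence
import Summits.Ventures.PercRepro2.Harris
import Summits.Ventures.PercRepro2.Graph
import Summits.Ventures.PercRepro2.Exploration
import Summits.Ventures.PercRepro2.Events
import Summits.Ventures.PercRepro2.Induced
import Summits.Ventures.PercRepro2.BHK
import Summits.Ventures.PercRepro2.BHKEvents
import Summits.Ventures.PercRepro2.OneEdge
import Summits.Ventures.PercRepro2.RBRoot

/-!
# Row 2′RB: removing a root edge at the third vertex, I — atoms and the pinned weights
(mine-a g5; MINE-A.md §31; continued in `RBRootEdgePin.lean` and `RBRootEdgeMain.lean`)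

For an edge `e = {w, s}` between the third vertex `w` and the root `s`: the connection relation
after forcing `e` open (`OneEdge.conn_update_true_iff`), the forcing identities for probabilities,
and the structure of the atoms `{C(w) = A}` — for `s ∉ A` the edge is closed on the atom, for
`s ∈ A` the events `{b ↔ s}` and `{o ↔ t}` factor through the atom with weight-independent
factors (spatial Markov, `prob_clusterEvent_inter_connEvent`).
-/

namespace Summit.Ventures.PercRepro2

namespace RBRootEdge

open scoped Classical

section Conn

variable {V : Type*} {E : Type*} [DecidableEq E] {ends : E → Sym2 V}

/-- Forcing `e = {w, s}` open: `x ↔ y` becomes `x ↔ y ∨ (x ↔ w ∧ s ↔ y) ∨ (x ↔ s ∧ w ↔ y)`. -/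
lemma conn_force_iff {e : E} {w s : V} (hends : ends e = s(w, s)) (ω : Config E) (x y : V) :
    Conn ends (Function.update ω e true) x y ↔
      Conn ends ω x y ∨ (Conn ends ω x w ∧ Conn ends ω s y) ∨ (Conn ends ω x s ∧ Conn ends ω w y) :=
  OneEdge.conn_update_true_iff hends ω x y

/-- Forcing `e = {w, s}` open, `Q = {s ↮ t}` becomes `{s ↮ t} ∩ {w ↮ t}`. -/
lemma force_mem_compl_connEvent {e : E} {w s t : V} (hends : ends e = s(w, s)) (ω : Config E) :
    Function.update ω e true ∈ (connEvent ends s t)ᶜ ↔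
      ω ∈ (connEvent ends s t)ᶜ ∧ ω ∈ (connEvent ends w t)ᶜ := by
  simp only [Set.mem_compl_iff, mem_connEvent, conn_force_iff hends]
  constructor
  · intro h
    exact ⟨fun h' => h (Or.inl h'), fun h' => h (Or.inr (Or.inr ⟨conn_refl _ _ _, h'⟩))⟩
  · rintro ⟨h1, h2⟩ (h | ⟨_, h'⟩ | ⟨_, h'⟩)
    · exact h1 h
    · exact h1 h'
    · exact h2 h'

/-- Forcing `e = {w, s}` open, `{b ↔ s}` becomes `{b ↔ s} ∪ {b ↔ w}`. -/
lemma force_mem_connEvent_root {e : E} {w s b : V} (hends : ends e = s(w, s)) (ω : Config E) :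
    Function.update ω e true ∈ connEvent ends b s ↔
      ω ∈ connEvent ends b s ∨ ω ∈ connEvent ends b w := by
  simp only [mem_connEvent, conn_force_iff hends]
  constructor
  · rintro (h | ⟨h, _⟩ | ⟨h, _⟩)
    · exact Or.inl h
    · exact Or.inr h
    · exact Or.inl h
  · rintro (h | h)
    · exact Or.inl h
    · exact Or.inr (Or.inl ⟨h, conn_refl _ _ _⟩)

/-- Forcing `e = {w, s}` open on `{s ↮ t} ∩ {w ↮ t}`, `{o ↔ t}` is unchanged. -/
lemma force_mem_connEvent_other {e : E} {w s t o : V} (hends : ends e = s(w, s)) (ω : Config E)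
    (hQ : ω ∈ (connEvent ends s t)ᶜ) (hw : ω ∈ (connEvent ends w t)ᶜ) :
    Function.update ω e true ∈ connEvent ends o t ↔ ω ∈ connEvent ends o t := by
  simp only [mem_connEvent, conn_force_iff hends]
  constructor
  · rintro (h | ⟨_, h⟩ | ⟨_, h⟩)
    · exact h
    · exact absurd h hQ
    · exact absurd h hw
  · exact fun h => Or.inl h

end Conn

section Pin

variable {V : Type*} {E : Type*} [Fintype E] [DecidableEq E] {R : Type*} [CommRing R]

/-- Forcing identity for probabilities: `P_{p[e↦1]}(S) = P_p({ω | ω[e ↦ open] ∈ S})`. -/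
lemma prob_update_one_eq (p : E → R) (e : E) (S : Set (Config E)) :
    prob (Function.update p e 1) S = prob p {ω | Function.update ω e true ∈ S} := by
  rw [prob_eq_expect_indicator, prob_eq_expect_indicator, expect_update_one]
  refine congrArg _ (funext fun ω => ?_)
  by_cases h : Function.update ω e true ∈ S
  · simp [h]
  · simp [h]

/-- Forcing identity for probabilities: `P_{p[e↦0]}(S) = P_p({ω | ω[e ↦ closed] ∈ S})`. -/
lemma prob_update_zero_eq (p : E → R) (e : E) (S : Set (Config E)) :
    prob (Function.update p e 0) S = prob p {ω | Function.update ω e false ∈ S} := by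
  rw [prob_eq_expect_indicator, prob_eq_expect_indicator, expect_update_zero]
  refine congrArg _ (funext fun ω => ?_)
  by_cases h : Function.update ω e false ∈ S
  · simp [h]
  · simp [h]

omit [Fintype E] in
/-- `p[e ↦ 0][e ↦ 1] = p[e ↦ 1]`. -/
lemma update_zero_update_one (p : E → R) (e : E) :
    Function.update (Function.update p e 0) e 1 = Function.update p e 1 :=
  Function.update_idem _ _ _

end Pin

section Atoms

variable {V : Type*} {E : Type*} [Fintype E] [DecidableEq E] [Fintype V] {R : Type*} [Field R]
  [LinearOrder R] [IsStrictOrderedRing R] (p : E → R) (ends : E → Sym2 V) (s t w : V) {e : E}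

omit [Fintype E] [DecidableEq E] [Fintype V] [Field R] [LinearOrder R] [IsStrictOrderedRing R] in
/-- If `x ∈ C(v)` then `C(x) = C(v)`. -/
lemma cluster_eq_of_mem {ω : Config E} {v x : V} (hx : x ∈ cluster ends ω v) :
    cluster ends ω x = cluster ends ω v := by
  ext y
  simp only [mem_cluster] at hx ⊢
  exact ⟨fun h => conn_trans hx h, fun h => conn_trans (conn_symm hx) h⟩

omit [Fintype E] [DecidableEq E] [Fintype V] [Field R] [LinearOrder R] [IsStrictOrderedRing R] in
/-- On `{C(w) = A}` with `s ∉ A` the edge `e = {w, s}` is closed. -/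
lemma clusterEvent_subset_closedEdge (hends : ends e = s(w, s)) {A : Set V} (hs : s ∉ A) :
    clusterEvent ends w A ⊆ closedEdge e := by
  intro ω hω
  rw [mem_closedEdge]
  by_contra h
  have he : ω e = true := by simpa using h
  apply hs
  rw [← hω]
  exact conn_of_openAdj ⟨e, he, hends⟩

omit [Fintype V] [LinearOrder R] [IsStrictOrderedRing R] in
/-- For `s ∉ A`: `P_p(Z ∩ {C(w) = A}) = (1 − p e) · P_{p[e↦0]}(Z ∩ {C(w) = A})`. -/
lemma prob_atom_of_notMem (hends : ends e = s(w, s)) {A : Set V} (hs : s ∉ A) (Z : Set (Config E)) :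
    prob p (Z ∩ clusterEvent ends w A) =
      (1 - p e) * prob (Function.update p e 0) (Z ∩ clusterEvent ends w A) := by
  have h : Z ∩ clusterEvent ends w A = Z ∩ clusterEvent ends w A ∩ closedEdge e :=
    (Set.inter_eq_left.2 (Set.inter_subset_right.trans
      (clusterEvent_subset_closedEdge ends s w hends hs))).symm
  rw [show prob p (Z ∩ clusterEvent ends w A) =
      prob p (Z ∩ clusterEvent ends w A ∩ closedEdge e) by rw [← h],
    prob_inter_closedEdge]

omit [Fintype V] [LinearOrder R] [IsStrictOrderedRing R] in
/-- For `s ∉ A`: `P_{p[e↦1]}(Z ∩ {C(w) = A}) = 0`. -/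
lemma prob_update_one_atom_of_notMem (hends : ends e = s(w, s)) {A : Set V} (hs : s ∉ A)
    (Z : Set (Config E)) : prob (Function.update p e 1) (Z ∩ clusterEvent ends w A) = 0 := by
  have h : Z ∩ clusterEvent ends w A = Z ∩ clusterEvent ends w A ∩ closedEdge e :=
    (Set.inter_eq_left.2 (Set.inter_subset_right.trans
      (clusterEvent_subset_closedEdge ends s w hends hs))).symm
  rw [show prob (Function.update p e 1) (Z ∩ clusterEvent ends w A) =
      prob (Function.update p e 1) (Z ∩ clusterEvent ends w A ∩ closedEdge e) by rw [← h],
    prob_update_one_inter_closedEdge]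

omit [Fintype E] [DecidableEq E] [Fintype V] [Field R] [LinearOrder R] [IsStrictOrderedRing R] in
/-- On `{C(w) = A}` with `s ∈ A`, `Q = {s ↮ t}` holds iff `t ∉ A`: `Q ∩ {C(w) = A} = ∅` when
`t ∈ A` … -/
lemma compl_inter_atom_of_mem_mem {A : Set V} (hs : s ∈ A) (ht : t ∈ A) :
    (connEvent ends s t)ᶜ ∩ clusterEvent ends w A = ∅ := by
  ext ω
  simp only [Set.mem_inter_iff, Set.mem_compl_iff, mem_connEvent, mem_clusterEvent,
    Set.mem_empty_iff_false, iff_false, not_and]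
  intro hQ hC
  apply hQ
  rw [← hC] at hs ht
  exact conn_trans (conn_symm hs) ht

omit [Fintype E] [DecidableEq E] [Fintype V] [Field R] [LinearOrder R] [IsStrictOrderedRing R] in
/-- … and `Q ∩ {C(w) = A} = {C(w) = A}` when `s ∈ A`, `t ∉ A`. -/
lemma compl_inter_atom_of_mem_notMem {A : Set V} (hs : s ∈ A) (ht : t ∉ A) :
    (connEvent ends s t)ᶜ ∩ clusterEvent ends w A = clusterEvent ends w A := by
  ext ω
  simp only [Set.mem_inter_iff, Set.mem_compl_iff, mem_connEvent, mem_clusterEvent,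
    and_iff_right_iff_imp]
  intro hC h
  apply ht
  rw [← hC] at hs ⊢
  exact conn_trans hs h

omit [Fintype E] [DecidableEq E] [Fintype V] [Field R] [LinearOrder R] [IsStrictOrderedRing R] in
/-- On `{C(w) = A}` with `s ∈ A`: `{b ↔ s}` holds iff `b ∈ A` (the atom is inside). -/
lemma atom_inter_connEvent_of_mem {A : Set V} (hs : s ∈ A) {b : V} (hb : b ∈ A) :
    clusterEvent ends w A ∩ connEvent ends b s = clusterEvent ends w A := by
  ext ω
  simp only [Set.mem_inter_iff, mem_connEvent, mem_clusterEvent, and_iff_left_iff_imp]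
  intro hC
  rw [← hC] at hs hb
  exact conn_trans (conn_symm hb) hs

omit [Fintype E] [DecidableEq E] [Fintype V] [Field R] [LinearOrder R] [IsStrictOrderedRing R] in
/-- On `{C(w) = A}` with `s ∈ A`: `{b ↔ s}` is impossible when `b ∉ A`. -/
lemma atom_inter_connEvent_of_notMem {A : Set V} (hs : s ∈ A) {b : V} (hb : b ∉ A) :
    clusterEvent ends w A ∩ connEvent ends b s = ∅ := by
  ext ω
  simp only [Set.mem_inter_iff, mem_connEvent, mem_clusterEvent, Set.mem_empty_iff_false,
    iff_false, not_and]
  intro hC h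
  apply hb
  rw [← hC] at hs ⊢
  exact conn_trans hs (conn_symm h)

omit [Fintype V] [LinearOrder R] [IsStrictOrderedRing R] in
/-- An event determined by the edges not touching `A` has the same probability under `p` and
under `p[e ↦ 1]` when `e` touches `A`. -/
lemma prob_update_one_of_dependsOn {A : Set V} (he : e ∈ touches ends A) {S : Set (Config E)}
    (hS : DependsOn (· ∈ S) (touches ends A)ᶜ) : prob (Function.update p e 1) S = prob p S := by
  rw [prob_update_one_eq]
  congr 1
  ext ω
  simp only [Set.mem_setOf_eq]
  exact dependsOn_mem_iff hS fun e' he' => by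
    rw [Function.update_of_ne]
    rintro rfl
    exact he' he

omit [Fintype V] [LinearOrder R] [IsStrictOrderedRing R] in
/-- … and under `p[e ↦ 0]`. -/
lemma prob_update_zero_of_dependsOn {A : Set V} (he : e ∈ touches ends A) {S : Set (Config E)}
    (hS : DependsOn (· ∈ S) (touches ends A)ᶜ) : prob (Function.update p e 0) S = prob p S := by
  rw [prob_update_zero_eq]
  congr 1
  ext ω
  simp only [Set.mem_setOf_eq]
  exact dependsOn_mem_iff hS fun e' he' => by
    rw [Function.update_of_ne]
    rintro rfl
    exact he' he

end Atoms

section Affine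

variable {V : Type*} {E : Type*} [Fintype E] [DecidableEq E] [Fintype V] {R : Type*} [Field R]
  [LinearOrder R] [IsStrictOrderedRing R] (p : E → R) (ends : E → Sym2 V) (s t w : V) {e : E}

omit [Fintype E] [DecidableEq E] [Fintype V] [LinearOrder R] [IsStrictOrderedRing R] in
/-- Algebra: if `a = d·c₁` and `b = d·c₂` then `a·b/d = d·(c₁·c₂)` (also for `d = 0`). -/
lemma mul_div_of_factor {a b d c₁ c₂ : R} (ha : a = d * c₁) (hb : b = d * c₂) :
    a * b / d = d * (c₁ * c₂) := by
  subst ha hb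
  by_cases hd : d = 0
  · simp [hd]
  · field_simp

omit [Fintype E] [DecidableEq E] [Fintype V] [LinearOrder R] [IsStrictOrderedRing R] in
/-- The atom term is affine in the weight of `e` as soon as the numerators factor through the
denominators with weight-independent factors. -/
lemma affine_of_factor {q a a0 a1 b b0 b1 d d0 d1 c₁ c₂ : R}
    (hd : d = q * d1 + (1 - q) * d0) (ha : a = d * c₁) (ha0 : a0 = d0 * c₁) (ha1 : a1 = d1 * c₁)
    (hb : b = d * c₂) (hb0 : b0 = d0 * c₂) (hb1 : b1 = d1 * c₂) :
    a * b / d = q * (a1 * b1 / d1) + (1 - q) * (a0 * b0 / d0) := by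
  rw [mul_div_of_factor ha hb, mul_div_of_factor ha0 hb0, mul_div_of_factor ha1 hb1, hd]
  ring

omit [Fintype V] [LinearOrder R] [IsStrictOrderedRing R] in
/-- On `{C(w) = A}` with `s ∈ A`, `P(atom ∩ {b ↔ s}) = P(atom) · 1[b ∈ A]`. -/
lemma prob_atom_inter_conn_root {A : Set V} (hs : s ∈ A) (b : V) :
    prob p (clusterEvent ends w A ∩ connEvent ends b s) =
      prob p (clusterEvent ends w A) * (if b ∈ A then 1 else 0) := by
  by_cases hb : b ∈ A
  · rw [atom_inter_connEvent_of_mem ends s w hs hb, if_pos hb, mul_one]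
  · rw [atom_inter_connEvent_of_notMem ends s w hs hb, if_neg hb, mul_zero, prob_empty]

omit [LinearOrder R] [IsStrictOrderedRing R] in
/-- On `{C(w) = A}` with `t ∉ A`: `P(atom ∩ {o ↔ t}) = P(atom) · κ_o(A)` with
`κ_o(A) = 0` if `o ∈ A` and `κ_o(A) = P(o ↔ t after closing the edges touching A)` otherwise. -/
lemma prob_atom_inter_conn_other {A : Set V} (ht : t ∉ A) (o : V) :
    prob p (clusterEvent ends w A ∩ connEvent ends o t) =
      prob p (clusterEvent ends w A) *
        (if o ∈ A then 0 else prob p {ω | Conn ends (restrict (touches ends A)ᶜ ω) o t}) := by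
  by_cases ho : o ∈ A
  · rw [if_pos ho, mul_zero]
    have h : clusterEvent ends w A ∩ connEvent ends o t = ∅ := by
      ext ω
      simp only [Set.mem_inter_iff, mem_connEvent, mem_clusterEvent, Set.mem_empty_iff_false,
        iff_false, not_and]
      intro hC h
      apply ht
      rw [← hC] at ho ⊢
      exact conn_trans ho h
    rw [h, prob_empty]
  · rw [if_neg ho]
    exact prob_clusterEvent_inter_connEvent p ends w A ho

omit [Fintype E] [DecidableEq E] [Fintype V] [Field R] [LinearOrder R] [IsStrictOrderedRing R] in
/-- `e = {w, s}` touches `A` when `s ∈ A`. -/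
lemma mem_touches_of_mem (hends : ends e = s(w, s)) {A : Set V} (hs : s ∈ A) :
    e ∈ touches ends A :=
  ⟨s, hs, w, by rw [hends, Sym2.eq_swap]⟩

omit [LinearOrder R] [IsStrictOrderedRing R] in
/-- The residual factor `κ_o(A)` does not depend on the weight of `e` (`s ∈ A`). -/
lemma kappa_update_one (hends : ends e = s(w, s)) {A : Set V} (hs : s ∈ A) (o : V) :
    prob (Function.update p e 1) {ω | Conn ends (restrict (touches ends A)ᶜ ω) o t} =
      prob p {ω | Conn ends (restrict (touches ends A)ᶜ ω) o t} :=
  prob_update_one_of_dependsOn p ends (mem_touches_of_mem ends s w hends hs)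
    (dependsOn_restrict (touches ends A)ᶜ fun ω' => Conn ends ω' o t)

omit [LinearOrder R] [IsStrictOrderedRing R] in
/-- The residual factor `κ_o(A)` does not depend on the weight of `e` (`s ∈ A`). -/
lemma kappa_update_zero (hends : ends e = s(w, s)) {A : Set V} (hs : s ∈ A) (o : V) :
    prob (Function.update p e 0) {ω | Conn ends (restrict (touches ends A)ᶜ ω) o t} =
      prob p {ω | Conn ends (restrict (touches ends A)ᶜ ω) o t} :=
  prob_update_zero_of_dependsOn p ends (mem_touches_of_mem ends s w hends hs)
    (dependsOn_restrict (touches ends A)ᶜ fun ω' => Conn ends ω' o t)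

end Affine

end RBRootEdge

end Summit.Ventures.PercRepro2
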